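import Mathlib
import HarnessLib
import Literature.Computability.AlgebraicComplexity.MatrixMultiplicationExponent
import Literature.Computability.AlgebraicComplexity.QuantumFunctionals
import Literature.Computability.AlgebraicComplexity.QuantumFunctionalsFree
import Literature.Computability.AlgebraicComplexity.QuantumFunctionalPoint

/-!
# OutsiderSandwich — every quantum functional reads `4` at `⟨2,2,2⟩` (the CVZ family sits on `τ = 2`)

Census hand K18 of the lens-4 node (generation 13), in kernel and route-independent.  In the node's
coordinates a universal spectral point `F` is the pair `(τ_F, x_F) = (log₂ F⟨2,2,2⟩, log₂ F(cw₂))`, and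
both cruxes of the cut of record are letters about this pair-spectrum `X` against the floor line
`x = log₂ 3 + (τ − 2)/3` (`LaserCutIsSpectral`).  The only explicitly known universal points over `ℂ`
beyond the gauge points are the quantum functionals `F^θ`, `θ ∈ P([3])` (Christandl–Vrana–Zuiddam 2023,
Cor. 3.31; tree: `quantumFunctionalPoint`, `ChristandlVranaZuiddam2023_mem_asymptoticSpectrum`).  Here:

* `quantumFunctional_matMulTensor_two_eq_four` — `F^θ(⟨2,2,2⟩) = 4` for every `θ` in the simplex
  (lower bound: the support of `⟨2,2,2⟩` is FREE and the uniform distribution on it has all three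
  marginals uniform on `4` points, so `E_θ ≥ 2` by the free-support bound, CVZ Thm. 4.20 (tree, proved:
  `weightedEntropy_le_logQuantumFunctional_of_isFreeSet`); upper bound: the dimension bound
  `E_θ ≤ ∑ θᵢ log₂ 4 = 2`, CVZ Thm. 3.19.5 (tree, proved: `logQuantumFunctional_le`));
* `quantumFunctionalPoint_matMulTensor_two_eq_four`, `logb_quantumFunctionalPoint_matMulTensor_two` —
  the same for the packaged spectral map: `τ_{F^θ} = 2`;
* `not_two_add_le_logb_quantumFunctionalPoint` — consequently NO quantum functional meets the
  hypothesis `2 + η ≤ τ_F` (`η > 0`) of the letter `LaserFloorStrict`: the CVZ family is silent on the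
  attacked crux, and (with `quantumFunctionalPoint_cwTensor_two_eq_three`, already in the tree) every
  `F^θ` sits exactly at the gauge corner `(2, log₂ 3)` of `X` — the known part of `X` is one point.

This was item `QuantumValueAtMM2` of the retired route DarkPointsByLogic (mooted unproved); it is proved
here because the lens-4 node uses it («the known spectrum is the corner»).

References: Christandl–Vrana–Zuiddam, J. Amer. Math. Soc. 36 (2023), Thm. 3.19.5, Def. 4.17,
Thm. 4.20, Cor. 3.31; Strassen, J. reine angew. Math. 413 (1991), §6.
-/

-- the problem's namespace `Summit.MatrixMultiplication.MatrixMultiplication` repeats the summit name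
set_option linter.dupNamespace false

namespace Summit.MatrixMultiplication.MatrixMultiplication.Theorems.OutsiderSandwichQuantumCorner

open Literature.Computability.AlgebraicComplexity

/-! ## The support of `⟨2,2,2⟩` is free and carries a distribution with uniform marginals -/

/-- The support of `⟨2,2,2⟩` (in the standard bases). [folklore] -/
theorem tensorSupport_matMulTensor_two :
    tensorSupport (matMulTensor ℂ 2 2 2) =
      ({p : (Fin 2 × Fin 2) × (Fin 2 × Fin 2) × (Fin 2 × Fin 2) |
        p.1.1 = p.2.1.1 ∧ p.2.1.2 = p.2.2.1 ∧ p.1.2 = p.2.2.2} :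
        Set ((Fin 2 × Fin 2) × (Fin 2 × Fin 2) × (Fin 2 × Fin 2))) := by
  ext p
  simp [matMulTensor]

/-- The matrix multiplication support is free: each index pair determines the third index
(CVZ Def. 4.17; `⟨n,n,n⟩` is free, Rem. 4.19). [cite: ChristandlVranaZuiddam2023, Def. 4.17] -/
theorem isFreeSet_mmCells :
    IsFreeSet ({p : (Fin 2 × Fin 2) × (Fin 2 × Fin 2) × (Fin 2 × Fin 2) |
        p.1.1 = p.2.1.1 ∧ p.2.1.2 = p.2.2.1 ∧ p.1.2 = p.2.2.2} :
        Set ((Fin 2 × Fin 2) × (Fin 2 × Fin 2) × (Fin 2 × Fin 2))) := by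
  refine ⟨?_, ?_, ?_⟩
  · rintro ⟨a, b, c⟩ ⟨h1, h2, h3⟩ ⟨a', b', c'⟩ ⟨h1', h2', h3'⟩ h
    simp only [Prod.mk.injEq] at h h1 h2 h3 h1' h2' h3' ⊢
    obtain ⟨rfl, rfl⟩ := h
    exact ⟨rfl, rfl, Prod.ext (h2.symm.trans h2') (h3.symm.trans h3')⟩
  · rintro ⟨a, b, c⟩ ⟨h1, h2, h3⟩ ⟨a', b', c'⟩ ⟨h1', h2', h3'⟩ h
    simp only [Prod.mk.injEq] at h h1 h2 h3 h1' h2' h3' ⊢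
    obtain ⟨rfl, rfl⟩ := h
    exact ⟨rfl, Prod.ext (h1.symm.trans h1') (h2.trans h2'.symm), rfl⟩
  · rintro ⟨a, b, c⟩ ⟨h1, h2, h3⟩ ⟨a', b', c'⟩ ⟨h1', h2', h3'⟩ h
    simp only [Prod.mk.injEq] at h h1 h2 h3 h1' h2' h3' ⊢
    obtain ⟨rfl, rfl⟩ := h
    exact ⟨Prod.ext (h1.trans h1'.symm) (h3.trans h3'.symm), rfl, rfl⟩

/-- In the standard bases (`g₀ = 1`) the support of `⟨2,2,2⟩` is free. [folklore] -/
theorem isFreeSet_tensorSupport_act_one_matMulTensor_two :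
    IsFreeSet (tensorSupport (actTensor
      (((1 : GL (Fin 2 × Fin 2) ℂ), (1 : GL (Fin 2 × Fin 2) ℂ), (1 : GL (Fin 2 × Fin 2) ℂ)).1 :
        Matrix (Fin 2 × Fin 2) (Fin 2 × Fin 2) ℂ)
      (((1 : GL (Fin 2 × Fin 2) ℂ), (1 : GL (Fin 2 × Fin 2) ℂ), (1 : GL (Fin 2 × Fin 2) ℂ)).2.1 :
        Matrix (Fin 2 × Fin 2) (Fin 2 × Fin 2) ℂ)
      (((1 : GL (Fin 2 × Fin 2) ℂ), (1 : GL (Fin 2 × Fin 2) ℂ), (1 : GL (Fin 2 × Fin 2) ℂ)).2.2 :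
        Matrix (Fin 2 × Fin 2) (Fin 2 × Fin 2) ℂ)
      (matMulTensor ℂ 2 2 2))) := by
  simp only [Units.val_one, actTensor_one, tensorSupport_matMulTensor_two]
  exact isFreeSet_mmCells

/-- The uniform distribution on the eight support cells is a probability distribution. [folklore] -/
theorem mmUniform_mem_stdSimplex :
    (fun p : (Fin 2 × Fin 2) × (Fin 2 × Fin 2) × (Fin 2 × Fin 2) =>
      if (p.1.1 = p.2.1.1 ∧ p.2.1.2 = p.2.2.1 ∧ p.1.2 = p.2.2.2) then (1 / 8 : ℝ) else 0) ∈
      stdSimplex ℝ ((Fin 2 × Fin 2) × (Fin 2 × Fin 2) × (Fin 2 × Fin 2)) := by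
  refine ⟨fun p => ?_, ?_⟩
  · dsimp only
    split_ifs <;> norm_num
  · simp [Fintype.sum_prod_type, Fin.sum_univ_two]
    norm_num

/-- Its support lies in the support of `⟨2,2,2⟩`. [folklore] -/
theorem support_mmUniform_subset :
    Function.support (fun p : (Fin 2 × Fin 2) × (Fin 2 × Fin 2) × (Fin 2 × Fin 2) =>
      if (p.1.1 = p.2.1.1 ∧ p.2.1.2 = p.2.2.1 ∧ p.1.2 = p.2.2.2) then (1 / 8 : ℝ) else 0) ⊆
      ({p : (Fin 2 × Fin 2) × (Fin 2 × Fin 2) × (Fin 2 × Fin 2) |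
        p.1.1 = p.2.1.1 ∧ p.2.1.2 = p.2.2.1 ∧ p.1.2 = p.2.2.2} :
        Set ((Fin 2 × Fin 2) × (Fin 2 × Fin 2) × (Fin 2 × Fin 2))) := by
  intro p hp
  rw [Function.mem_support] at hp
  by_contra h
  exact hp (if_neg h)

/-- First marginal: uniform on `Fin 2 × Fin 2`. [folklore] -/
theorem marginalDist₁_mmUniform :
    marginalDist₁ (fun p : (Fin 2 × Fin 2) × (Fin 2 × Fin 2) × (Fin 2 × Fin 2) =>
      if (p.1.1 = p.2.1.1 ∧ p.2.1.2 = p.2.2.1 ∧ p.1.2 = p.2.2.2) then (1 / 8 : ℝ) else 0) =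
      fun _ => (1 / 4 : ℝ) := by
  funext a
  obtain ⟨i, j⟩ := a
  fin_cases i <;> fin_cases j <;>
    simp [marginalDist₁, Fintype.sum_prod_type, Fin.sum_univ_two] <;> norm_num

/-- Second marginal: uniform on `Fin 2 × Fin 2`. [folklore] -/
theorem marginalDist₂_mmUniform :
    marginalDist₂ (fun p : (Fin 2 × Fin 2) × (Fin 2 × Fin 2) × (Fin 2 × Fin 2) =>
      if (p.1.1 = p.2.1.1 ∧ p.2.1.2 = p.2.2.1 ∧ p.1.2 = p.2.2.2) then (1 / 8 : ℝ) else 0) =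
      fun _ => (1 / 4 : ℝ) := by
  funext b
  obtain ⟨i, j⟩ := b
  fin_cases i <;> fin_cases j <;>
    simp [marginalDist₂, Fintype.sum_prod_type, Fin.sum_univ_two] <;> norm_num

/-- Third marginal: uniform on `Fin 2 × Fin 2`. [folklore] -/
theorem marginalDist₃_mmUniform :
    marginalDist₃ (fun p : (Fin 2 × Fin 2) × (Fin 2 × Fin 2) × (Fin 2 × Fin 2) =>
      if (p.1.1 = p.2.1.1 ∧ p.2.1.2 = p.2.2.1 ∧ p.1.2 = p.2.2.2) then (1 / 8 : ℝ) else 0) =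
      fun _ => (1 / 4 : ℝ) := by
  funext c
  obtain ⟨i, j⟩ := c
  fin_cases i <;> fin_cases j <;>
    simp [marginalDist₃, Fintype.sum_prod_type, Fin.sum_univ_two] <;> norm_num

/-- `H(uniform on 4 points) = 2`. [folklore] -/
theorem shannonEntropy_uniform_four :
    shannonEntropy (fun _ : Fin 2 × Fin 2 => (1 / 4 : ℝ)) = 2 := by
  have h : Real.log ((1 : ℝ) / 4) = -Real.log 4 := by rw [one_div, Real.log_inv]
  have h2 : Real.log 2 ≠ 0 := Real.log_ne_zero_of_pos_of_ne_one two_pos (by norm_num)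
  have h4 : Real.log 4 = 2 * Real.log 2 := by
    rw [show (4 : ℝ) = 2 ^ 2 by norm_num, Real.log_pow]
    norm_num
  simp only [shannonEntropy, Real.negMulLog, Finset.sum_const, Finset.card_univ, Fintype.card_prod,
    Fintype.card_fin, nsmul_eq_mul, h, h4]
  push_cast
  field_simp

/-- `H_θ(uniform on the support of ⟨2,2,2⟩) = 2 (θ₀ + θ₁ + θ₂)`. [folklore] -/
theorem weightedEntropy_mmUniform (θ : Fin 3 → ℝ) :
    weightedEntropy θ (fun p : (Fin 2 × Fin 2) × (Fin 2 × Fin 2) × (Fin 2 × Fin 2) =>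
      if (p.1.1 = p.2.1.1 ∧ p.2.1.2 = p.2.2.1 ∧ p.1.2 = p.2.2.2) then (1 / 8 : ℝ) else 0) =
      (θ 0 + θ 1 + θ 2) * 2 := by
  simp only [weightedEntropy, marginalDist₁_mmUniform, marginalDist₂_mmUniform,
    marginalDist₃_mmUniform, shannonEntropy_uniform_four]
  ring

/-- `⟨2,2,2⟩ ≠ 0`. [folklore] -/
theorem matMulTensor_two_ne_zero : matMulTensor ℂ 2 2 2 ≠ 0 := by
  intro h
  have := congrFun (congrFun (congrFun h ((0 : Fin 2), (0 : Fin 2))) ((0 : Fin 2), (0 : Fin 2)))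
    ((0 : Fin 2), (0 : Fin 2))
  simp [matMulTensor] at this

/-! ## The value `F^θ(⟨2,2,2⟩) = 4` -/

/-- **Every quantum functional reads `4` at `⟨2,2,2⟩`** (`θ` in the probability simplex).
[cite: ChristandlVranaZuiddam2023, Thm. 4.20] -/
theorem quantumFunctional_matMulTensor_two_eq_four {θ : Fin 3 → ℝ}
    (hθ : θ ∈ stdSimplex ℝ (Fin 3)) : quantumFunctional θ (matMulTensor ℂ 2 2 2) = 4 := by
  have hθ0 : ∀ i, 0 ≤ θ i := fun i => hθ.1 i
  have hsum : θ 0 + θ 1 + θ 2 = 1 := by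
    have := hθ.2
    simpa [Fin.sum_univ_three] using this
  have h2 : Real.log 2 ≠ 0 := Real.log_ne_zero_of_pos_of_ne_one two_pos (by norm_num)
  -- lower bound `2 ≤ E_θ` from the uniform distribution on the free support
  have hPs : Function.support (fun p : (Fin 2 × Fin 2) × (Fin 2 × Fin 2) × (Fin 2 × Fin 2) =>
      if (p.1.1 = p.2.1.1 ∧ p.2.1.2 = p.2.2.1 ∧ p.1.2 = p.2.2.2) then (1 / 8 : ℝ) else 0) ⊆
      tensorSupport (actTensor
      (((1 : GL (Fin 2 × Fin 2) ℂ), (1 : GL (Fin 2 × Fin 2) ℂ), (1 : GL (Fin 2 × Fin 2) ℂ)).1 :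
        Matrix (Fin 2 × Fin 2) (Fin 2 × Fin 2) ℂ)
      (((1 : GL (Fin 2 × Fin 2) ℂ), (1 : GL (Fin 2 × Fin 2) ℂ), (1 : GL (Fin 2 × Fin 2) ℂ)).2.1 :
        Matrix (Fin 2 × Fin 2) (Fin 2 × Fin 2) ℂ)
      (((1 : GL (Fin 2 × Fin 2) ℂ), (1 : GL (Fin 2 × Fin 2) ℂ), (1 : GL (Fin 2 × Fin 2) ℂ)).2.2 :
        Matrix (Fin 2 × Fin 2) (Fin 2 × Fin 2) ℂ)
      (matMulTensor ℂ 2 2 2)) := by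
    simp only [Units.val_one, actTensor_one, tensorSupport_matMulTensor_two]
    exact support_mmUniform_subset
  have hlow := weightedEntropy_le_logQuantumFunctional_of_isFreeSet hθ0 (matMulTensor ℂ 2 2 2) _
    isFreeSet_tensorSupport_act_one_matMulTensor_two mmUniform_mem_stdSimplex hPs
  rw [weightedEntropy_mmUniform, hsum, one_mul] at hlow
  -- upper bound `E_θ ≤ log₂ 4 = 2`
  have hup : logQuantumFunctional θ (matMulTensor ℂ 2 2 2) ≤ 2 := by
    have := logQuantumFunctional_le hθ0 (matMulTensor ℂ 2 2 2)
    simp only [Fintype.card_prod, Fintype.card_fin] at this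
    have h4 : Real.log (2 * 2) / Real.log 2 = 2 := by
      rw [show (2 : ℝ) * 2 = 2 ^ 2 by norm_num, Real.log_pow]
      field_simp
      norm_num
    calc logQuantumFunctional θ (matMulTensor ℂ 2 2 2)
        ≤ θ 0 * (Real.log (2 * 2) / Real.log 2) + θ 1 * (Real.log (2 * 2) / Real.log 2) +
            θ 2 * (Real.log (2 * 2) / Real.log 2) := by exact_mod_cast this
      _ = (θ 0 + θ 1 + θ 2) * (Real.log (2 * 2) / Real.log 2) := by ring
      _ = 2 := by rw [hsum, one_mul, h4]
  have heq : logQuantumFunctional θ (matMulTensor ℂ 2 2 2) = 2 := le_antisymm hup hlow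
  rw [quantumFunctional_of_ne_zero θ matMulTensor_two_ne_zero, heq]
  norm_num

/-- The packaged spectral map `F^θ` reads `4` at `⟨2,2,2⟩`. [cite: ChristandlVranaZuiddam2023, Thm. 4.20] -/
theorem quantumFunctionalPoint_matMulTensor_two_eq_four {θ : Fin 3 → ℝ}
    (hθ : θ ∈ stdSimplex ℝ (Fin 3)) : quantumFunctionalPoint θ (matMulTensor ℂ 2 2 2) = 4 := by
  rw [quantumFunctionalPoint_apply]
  exact quantumFunctional_matMulTensor_two_eq_four hθ

/-- In the node's coordinates: `τ_{F^θ} = log₂ F^θ(⟨2,2,2⟩) = 2` for every `θ`. [folklore] -/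
theorem logb_quantumFunctionalPoint_matMulTensor_two {θ : Fin 3 → ℝ}
    (hθ : θ ∈ stdSimplex ℝ (Fin 3)) :
    Real.logb 2 (quantumFunctionalPoint θ (matMulTensor ℂ 2 2 2)) = 2 := by
  rw [quantumFunctionalPoint_matMulTensor_two_eq_four hθ, show (4 : ℝ) = 2 ^ (2 : ℝ) by norm_num,
    Real.logb_rpow two_pos (by norm_num)]

/-- **The CVZ family is silent on `LaserFloorStrict`**: no quantum functional satisfies the letter's
hypothesis `2 + η ≤ τ_F` with `η > 0`. [folklore] -/
theorem not_two_add_le_logb_quantumFunctionalPoint {θ : Fin 3 → ℝ} (hθ : θ ∈ stdSimplex ℝ (Fin 3))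
    {η : ℝ} (hη : 0 < η) :
    ¬ (2 + η ≤ Real.logb 2 (quantumFunctionalPoint θ (matMulTensor ℂ 2 2 2))) := by
  rw [logb_quantumFunctionalPoint_matMulTensor_two hθ]
  linarith

end Summit.MatrixMultiplication.MatrixMultiplication.Theorems.OutsiderSandwichQuantumCorner
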